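import Mathlib
import Literature.Probability.Percolation.PercolationProofs
import Literature.Probability.Percolation.TwoClusterConditionalAssociation
import Summits.CriticalPhenomena.PercolationContinuityZ3.Theorems.PercNearOneGluingAdditiveGluingKnLemma3ii

/-!
# Crux `PercNearOneGluing.NoHeavyLowerTail` (stmt-CriticalPhenomena-4575), line
`bhk-superadditivity-thinning` — stub `blockExchange` (the block exchange inequality `BX_{Z,h}`)

Helper file for the crux skeleton (lead prover-line-stmt-CriticalPhenomena-4575-c3-0): proves
exactly the registered stub signature `blockExchange`; lands with
`--supports stmt-CriticalPhenomena-4575`.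

## Content

Weighted complete graph on `Fin n`, law `μ = prodBernoulli w` on `BondConfig (Fin n)`; write
`x ↔ y` for `ω ∈ openConn x y`.  For vertices `m, b, h`, a finite set `Z` of vertices and `z ∈ Z`
with `μ(m ↔ b) ≤ μ(z ↔ b)` ("`m` is at least as dead as `z`"):

`μ{m ↔ b, h ↮ b, Z ↮ b, h ↔ Z} ≤ μ{m ↮ b, m ↮ Z, Z ↔ b, m ↮ h}`.

## Proof

Put `Q = {m ↮ Z, m ↮ h}` ("the cluster of `m` avoids `Z ∪ {h}`").
* `Q` is decreasing and determined by the open edge cluster `C_m` of `m` in the sense of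
  Kozma–Nitzan Lemma 3(ii) (`blockExchange_Q_closed`): an open path from `m` to `x ≠ m` ends with
  an edge of `C_m` (`reachable_iff_exists_mem_openEdgeCluster`), so `C_m(ω) ⊆ C_m(ω')` and
  `ω' ∈ Q` force `ω ∈ Q`.
* The left event lies in `{m ↔ b} ∩ Q`: on it `m ↔ b`, and `m ↔ x` for some `x ∈ Z ∪ {h}` would
  give `x ↔ b`.
* KN Lemma 3(ii) (`stub_knLemma3ii`, in the tree) with `a₁ = m`, `a₂ = z`, `d = 0`:
  `μ({m ↔ b} ∩ Q) ≤ μ({z ↔ b} ∩ Q)`.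
* `{z ↔ b} ∩ Q` lies in the right event: `z ∈ Z` witnesses `Z ↔ b`, `Q` gives `m ↮ Z` and
  `m ↮ h`, and `m ↔ b` together with `z ↔ b` would give `m ↔ z`, contradicting `Q`.
-/

namespace Summit.CriticalPhenomena.PercolationContinuityZ3.Theorems

open MeasureTheory Set
open Literature.Probability.LatticeModels (prodBernoulli)
open Literature.Probability.Percolation (BondConfig openConn openGraph openEdgeCluster
  reachable_iff_exists_mem_openEdgeCluster)

noncomputable section
open Classical

section BlockExchangeAux

variable {n : ℕ}

/-- Monotonicity of `m ↔ x` in the open edge cluster of `m`: if `C_m(ω) ⊆ C_m(ω')` and `m ↔ x`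
in `ω`, then `m ↔ x` in `ω'` (an open path from `m` to `x ≠ m` ends with an edge of `C_m`).
[folklore] -/
theorem blockExchange_reach_mono (ω ω' : BondConfig (Fin n)) (m x : Fin n)
    (hsub : openEdgeCluster ω m ⊆ openEdgeCluster ω' m)
    (h : ω ∈ (openConn m x : Set (BondConfig (Fin n)))) :
    ω' ∈ (openConn m x : Set (BondConfig (Fin n))) := by
  rcases (reachable_iff_exists_mem_openEdgeCluster ω m x).1 h with rfl | ⟨e, he, hxe⟩
  · exact SimpleGraph.Reachable.refl _
  · exact (reachable_iff_exists_mem_openEdgeCluster ω' m x).2 (Or.inr ⟨e, hsub he, hxe⟩)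

/-- The event `Q = {m ↮ Z, m ↮ h}` ("the cluster of `m` avoids `Z ∪ {h}`") is decreasing and
determined by the open edge cluster of `m` in the sense of Kozma–Nitzan Lemma 3(ii): if `ω' ∈ Q`
and `C_m(ω) ⊆ C_m(ω')` then `ω ∈ Q`. [folklore] -/
theorem blockExchange_Q_closed (Z : Finset (Fin n)) (m h : Fin n) :
    ∀ ω ω' : BondConfig (Fin n),
      ω' ∈ {ω : BondConfig (Fin n) | (∀ z' ∈ Z, ω ∉ (openConn m z' : Set (BondConfig (Fin n)))) ∧
          ω ∉ (openConn m h : Set (BondConfig (Fin n)))} →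
      openEdgeCluster ω m ⊆ openEdgeCluster ω' m →
      ω ∈ {ω : BondConfig (Fin n) | (∀ z' ∈ Z, ω ∉ (openConn m z' : Set (BondConfig (Fin n)))) ∧
          ω ∉ (openConn m h : Set (BondConfig (Fin n)))} := by
  rintro ω ω' ⟨hZ', hh'⟩ hsub
  exact ⟨fun z' hz' hω => hZ' z' hz' (blockExchange_reach_mono ω ω' m z' hsub hω),
    fun hω => hh' (blockExchange_reach_mono ω ω' m h hsub hω)⟩

end BlockExchangeAux

/-- **The block exchange inequality `BX_{Z,h}`** (registered stub `blockExchange` of crux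
stmt-CriticalPhenomena-4575, line bhk-superadditivity-thinning).  On the weighted complete graph
`Fin n` with law `μ = prodBernoulli w`: if `z ∈ Z` and `μ(m ↔ b) ≤ μ(z ↔ b)`, then
`μ{m ↔ b, h ↮ b, Z ↮ b, h ↔ Z} ≤ μ{m ↮ b, m ↮ Z, Z ↔ b, m ↮ h}`.  From Kozma–Nitzan Lemma 3(ii)
(`stub_knLemma3ii`) applied to the decreasing `C_m`-determined event `Q = {m ↮ Z, m ↮ h}` with
`d = 0`; see the module docstring. [cite: KozmaNitzan2024, Lemma 3(ii)] -/
theorem blockExchange : ∀ (n : ℕ) (w : Sym2 (Fin n) → unitInterval) (m z b h : Fin n) (Z : Finset (Fin n)), z ∈ Z → (Literature.Probability.LatticeModels.prodBernoulli w).real (Literature.Probability.Percolation.openConn m b) ≤ (Literature.Probability.LatticeModels.prodBernoulli w).real (Literature.Probability.Percolation.openConn z b) → (Literature.Probability.LatticeModels.prodBernoulli w).real {ω : Literature.Probability.Percolation.BondConfig (Fin n) | ω ∈ Literature.Probability.Percolation.openConn m b ∧ ω ∉ Literature.Probability.Percolation.openConn h b ∧ (∀ z' ∈ Z, ω ∉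 Literature.Probability.Percolation.openConn z' b) ∧ (∃ z' ∈ Z, ω ∈ Literature.Probability.Percolation.openConn h z')} ≤ (Literature.Probability.LatticeModels.prodBernoulli w).real {ω : Literature.Probability.Percolation.BondConfig (Fin n) | ω ∉ Literature.Probability.Percolation.openConn m b ∧ (∀ z' ∈ Z, ω ∉ Literature.Probability.Percolation.openConn m z') ∧ (∃ z' ∈ Z, ω ∈ Literature.Probability.Percolation.openConn z' b) ∧ ω ∉ Literature.Probability.Percolation.openConn m h} := by
  intro n w m z b h Z hz hle
  -- the event `Q = {m ↮ Z, m ↮ h}`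
  set Q : Set (BondConfig (Fin n)) :=
    {ω : BondConfig (Fin n) | (∀ z' ∈ Z, ω ∉ (openConn m z' : Set (BondConfig (Fin n)))) ∧
      ω ∉ (openConn m h : Set (BondConfig (Fin n)))} with hQdef
  -- (1) KN Lemma 3(ii) with `a₁ = m`, `a₂ = z`, `d = 0`
  have hKN : (prodBernoulli w).real (openConn m b ∩ Q) ≤
      (prodBernoulli w).real (openConn z b ∩ Q) := by
    have h3 := stub_knLemma3ii n w m z b Q 0 (blockExchange_Q_closed Z m h) le_rfl
      (by rw [add_zero]; exact hle)
    rwa [add_zero] at h3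
  -- (2) the left event lies in `{m ↔ b} ∩ Q`
  have hA : {ω : BondConfig (Fin n) | ω ∈ (openConn m b : Set (BondConfig (Fin n))) ∧
      ω ∉ (openConn h b : Set (BondConfig (Fin n))) ∧
      (∀ z' ∈ Z, ω ∉ (openConn z' b : Set (BondConfig (Fin n)))) ∧
      (∃ z' ∈ Z, ω ∈ (openConn h z' : Set (BondConfig (Fin n))))} ⊆ openConn m b ∩ Q := by
    rintro ω ⟨hmb, hhb, hZb, -⟩
    refine ⟨hmb, fun z' hz' hmz' => hZb z' hz' ?_, fun hmh => hhb ?_⟩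
    · exact SimpleGraph.Reachable.trans (SimpleGraph.Reachable.symm hmz') hmb
    · exact SimpleGraph.Reachable.trans (SimpleGraph.Reachable.symm hmh) hmb
  -- (3) `{z ↔ b} ∩ Q` lies in the right event
  have hB : openConn z b ∩ Q ⊆ {ω : BondConfig (Fin n) |
      ω ∉ (openConn m b : Set (BondConfig (Fin n))) ∧
      (∀ z' ∈ Z, ω ∉ (openConn m z' : Set (BondConfig (Fin n)))) ∧
      (∃ z' ∈ Z, ω ∈ (openConn z' b : Set (BondConfig (Fin n)))) ∧
      ω ∉ (openConn m h : Set (BondConfig (Fin n)))} := by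
    rintro ω ⟨hzb, hZ', hh'⟩
    refine ⟨fun hmb => hZ' z hz ?_, hZ', ⟨z, hz, hzb⟩, hh'⟩
    exact SimpleGraph.Reachable.trans hmb (SimpleGraph.Reachable.symm hzb)
  calc (prodBernoulli w).real {ω : BondConfig (Fin n) |
          ω ∈ (openConn m b : Set (BondConfig (Fin n))) ∧
          ω ∉ (openConn h b : Set (BondConfig (Fin n))) ∧
          (∀ z' ∈ Z, ω ∉ (openConn z' b : Set (BondConfig (Fin n)))) ∧
          (∃ z' ∈ Z, ω ∈ (openConn h z' : Set (BondConfig (Fin n))))}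
      ≤ (prodBernoulli w).real (openConn m b ∩ Q) := measureReal_mono hA (measure_ne_top _ _)
    _ ≤ (prodBernoulli w).real (openConn z b ∩ Q) := hKN
    _ ≤ (prodBernoulli w).real {ω : BondConfig (Fin n) |
          ω ∉ (openConn m b : Set (BondConfig (Fin n))) ∧
          (∀ z' ∈ Z, ω ∉ (openConn m z' : Set (BondConfig (Fin n)))) ∧
          (∃ z' ∈ Z, ω ∈ (openConn z' b : Set (BondConfig (Fin n)))) ∧
          ω ∉ (openConn m h : Set (BondConfig (Fin n)))} := measureReal_mono hB (measure_ne_top _ _)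

end

end Summit.CriticalPhenomena.PercolationContinuityZ3.Theorems
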